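import Summits.QuantumAdvantage.QuantumAdvantage.Theses.ArithStatLadder
import Summits.QuantumAdvantage.QuantumAdvantage.Theorems.ArithStatLadderIqThreeMemBQPStubFrontEnd
import Summits.QuantumAdvantage.QuantumAdvantage.Theorems.ArithStatLadderIqThreeNotPPolyNagellSixFree
import Summits.QuantumAdvantage.QuantumAdvantage.Theorems.ArithStatLadderIqThreeNotBPP
import Summits.QuantumAdvantage.QuantumAdvantage.Theorems.ArithStatLadderIqThreeNotPPolyStubNatAdapter
import Literature.NumberTheory.QuadraticFields.ScholzReflectionArithmetic
import Literature.Computability.Cryptography.ClassBQPReductionProofs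
import Literature.Computability.Complexity.PPolyReductions
import Literature.Computability.Complexity.BPClosureProofs
import Literature.Computability.Complexity.CircuitClassesUniformProofs
import Literature.Computability.Complexity.StackBricksArith
import Literature.Computability.Complexity.FoldBricks
import Literature.Computability.Complexity.BranchingFn

/-!
# Crux `ArithStatLadder.IqThreeNotPPoly` (stmt-QuantumAdvantage-2422), line `Sketch` — WHAT THE APEX IS WORTH

Continuation lead `prover-line-stmt-QuantumAdvantage-2422-c4-0`. The line SQUAREFREE-FILTER DOMINATION is
complete modulo its apex `stub_sqfreeNotPPoly : SQF ∉ P/poly` (`SQF = bin {m | Squarefree m}`), a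
hypothesis-type circuit lower bound (landed: `IQ3 ∈ P/poly → SQF ∈ P/poly`,
`toLanguage_squarefree_mem_PPoly_of_iqThree_nagell`, p106985; uniform twin `SQF ∉ BPP → IqThreeNotBPP`,
crux 14864's `IqThreeNotBPP.iqThreeNotBPP_of_squarefree_not_mem_BPP`). This file settles, kernel-checked, what assuming that apex buys
THE SUMMIT — and the answer is: everything, with no class group in sight.

* `squarefree_mem_BQP` — **`SQUAREFREES ∈ BQP`, unconditionally** (the tree's strict class: P-uniform
  Clifford+T families, error `≤ 1/3`). Proof: the two-branch Karp reduction `SQF ≤ₚ FUND`,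
  `m ↦ m` if `m ≡ 3 (mod 4)` and `m ↦ 4m` otherwise (`squarefree_iff_isNegFundamentalDiscr_branch`:
  `−m` resp. `−4m` is a fundamental discriminant iff `m` is squarefree; non-numerals go to the
  non-numeral `[0]`), written as an `FP` brick composite (`exists_sqfToFundFn`), into the LANDED
  `IqThreeMemBQP.fund_mem_BQP` (`FUND = bin {d | −d fundamental} ∈ BQP`: Shor on the odd core, crux
  2424's front end) through the `PromiseBQP` Karp closure `mem_PromiseBQP_of_polyTimeReducible`.
* Hence **either squarefree apex closes the summit BY ITSELF**:
  `quantumAdvantage_of_squarefree_not_mem_BPP : SQF ∉ BPP → QuantumAdvantage` (witness `SQF`) and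
  `quantumAdvantage_of_squarefree_not_mem_PPoly : SQF ∉ P/poly → QuantumAdvantage` (Adleman,
  `BPP_subset_PPoly_holds`). Under the apex of this line (and under crux 14864's `stub_sqfreeNotBPP`)
  the witness `IQ3` and the quantum crux `IqThreeMemBQP` (stmt-2424) are REDUNDANT for `closes`:
  `closes_inputs_of_squarefree_not_mem_PPoly` delivers `IqThreeNotPPoly ∧ IqThreeNotBPP ∧
  QuantumAdvantage` from the apex alone. Planner-facing reading (D-0014): the honest top of line
  `Sketch` is a FACTORING-FAMILY hypothesis under which the route degenerates to Shor's witness.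
* `exists_fundToSqfFn`, `fund_mem_PPoly_iff_squarefree_mem_PPoly`, `fund_mem_BPP_iff_squarefree_mem_BPP`
  — the converse reduction `FUND ≤ₚ SQF` (`d ↦ d` if `d ≡ 3 (4)`, `d ↦ d/4` if `d ≡ 4, 8 (16)`,
  else `[0]`), so fundamentality recognition and squarefreeness testing are the SAME problem for
  `P/poly` and for `BPP`; consequently `iqThreeNotPPoly_of_fund_not_mem_PPoly : FUND ∉ P/poly →
  IqThreeNotPPoly` and `iqThreeNotBPP_of_fund_not_mem_BPP`. With the disprover's genus-theory
  collapse `IQ2 ∉ P/poly ↔ FUND ∉ P/poly` (`Negative/GenusTwoCollapse.lean`, p97018, revise-pending)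
  this reads: the `ℓ = 2` analogue of the crux implies the crux.

Theorems only (every map is an `∃ f ∈ FP` built inside a proof); imports are landed tree files.
-/

set_option linter.dupNamespace false -- D-0017: single-problem summit ⇒ `QuantumAdvantage.QuantumAdvantage` by design

noncomputable section

namespace Summit.QuantumAdvantage.QuantumAdvantage.Theorems.IqThreeNotPPoly

open _root_.Computability Literature.Computability.Complexity
open Literature.Computability.Complexity.Brick
open Literature.Computability.Cryptography (IsNegFundamentalDiscr BQP PromiseBQP
  mem_PromiseBQP_of_polyTimeReducible ofLanguage_mem_PromiseBQP_iff)
open Literature.NumberTheory.QuadraticFields (BinaryQuadraticForm.classNumber squarefree_neg_natCast_iff)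
open Summit.QuantumAdvantage.QuantumAdvantage.Theses.ArithStatLadder (IqThreeNotPPoly IqThreeNotBPP)
open Summit.QuantumAdvantage.QuantumAdvantage.Theorems.ArithStatLadder.IqThreeMemBQP (fund_mem_BQP)
open Summit.QuantumAdvantage.QuantumAdvantage.Theorems.IqThreeNotBPP (iqThreeNotBPP_of_squarefree_not_mem_BPP
  not_four_dvd_of_squarefree)

/-! ### Number theory of the two branches -/

/-- Branch `m ≡ 3 (mod 4)`: `−m` is a fundamental discriminant iff `m` is squarefree. [folklore] -/
theorem isNegFundamentalDiscr_iff_squarefree_of_mod_four {m : ℕ} (h3 : m % 4 = 3) :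
    IsNegFundamentalDiscr m ↔ Squarefree m := by
  unfold IsNegFundamentalDiscr
  constructor
  · rintro (⟨-, h2, -⟩ | ⟨h4, -, -⟩)
    · exact (squarefree_neg_natCast_iff m).1 h2
    · exfalso; omega
  · intro hs
    exact Or.inl ⟨by omega, (squarefree_neg_natCast_iff m).2 hs, by omega⟩

/-- Branch `m ≢ 3 (mod 4)`: `−4m` is a fundamental discriminant iff `m` is squarefree (for
`m ≡ 1, 2 (mod 4)` this is the even fundamental discriminant `−4m`; for `4 ∣ m` both sides fail).
[folklore] -/
theorem isNegFundamentalDiscr_four_mul_iff_squarefree {m : ℕ} (h3 : m % 4 ≠ 3) :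
    IsNegFundamentalDiscr (4 * m) ↔ Squarefree m := by
  have hcast : ((4 * m : ℕ) : ℤ) = 4 * (m : ℤ) := by push_cast; ring
  have hdiv : (-(4 * (m : ℤ))) / 4 = -(m : ℤ) := by omega
  unfold IsNegFundamentalDiscr
  rw [hcast, hdiv]
  constructor
  · rintro (⟨h1, -, -⟩ | ⟨-, -, h3'⟩)
    · exfalso; omega
    · exact (squarefree_neg_natCast_iff m).1 h3'
  · intro hs
    have h0 := not_four_dvd_of_squarefree hs
    exact Or.inr ⟨⟨-(m : ℤ), by ring⟩, by omega, (squarefree_neg_natCast_iff m).2 hs⟩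

/-- **The two-branch dictionary**: `m` is squarefree iff `−m` (when `m ≡ 3 (mod 4)`) resp. `−4m`
(otherwise) is a fundamental discriminant. [folklore] -/
theorem squarefree_iff_isNegFundamentalDiscr_branch (m : ℕ) :
    Squarefree m ↔ IsNegFundamentalDiscr (if m % 4 = 3 then m else 4 * m) := by
  split_ifs with h3
  · exact (isNegFundamentalDiscr_iff_squarefree_of_mod_four h3).symm
  · exact (isNegFundamentalDiscr_four_mul_iff_squarefree h3).symm

/-- The residues of a fundamental `−d`: `d ≡ 3 (mod 4)` or `d ≡ 4, 8 (mod 16)`. [folklore] -/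
theorem mod_of_isNegFundamentalDiscr {d : ℕ} (hF : IsNegFundamentalDiscr d) :
    d % 4 = 3 ∨ d % 16 = 4 ∨ d % 16 = 8 := by
  rcases hF with ⟨h1, -, -⟩ | ⟨h4, h2, -⟩
  · left; omega
  · right; omega

/-- Branch `d ≡ 4, 8 (mod 16)`: `−d` is fundamental iff `d / 4` is squarefree. [folklore] -/
theorem isNegFundamentalDiscr_iff_squarefree_div_four {d : ℕ} (h : d % 16 = 4 ∨ d % 16 = 8) :
    IsNegFundamentalDiscr d ↔ Squarefree (d / 4) := by
  have hd : d = 4 * (d / 4) := by omega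
  have h3 : (d / 4) % 4 ≠ 3 := by omega
  conv_lhs => rw [hd]
  exact isNegFundamentalDiscr_four_mul_iff_squarefree h3

/-! ### Words: numerals, non-numerals, membership -/

/-- A non-numeral word lies in no language of numerals. [folklore] -/
theorem not_mem_toLanguage_of_forall_ne (S : Set ℕ) {w : List Bool} (hw : ∀ m : ℕ, encodeNat m ≠ w) :
    w ∉ encodingNatBool.toLanguage S := by
  rintro ⟨m, -, hm⟩
  exact hw m hm

/-- `[0]` lies in no language of numerals (numerals are `[]` or end in `1`). [folklore] -/
theorem singleton_false_not_mem_toLanguage (S : Set ℕ) :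
    [false] ∉ encodingNatBool.toLanguage S := by
  refine not_mem_toLanguage_of_forall_ne S fun m h => ?_
  rcases isCanonicalNum_encodeNat m with h' | h'
  · rw [h] at h'; exact absurd h' (by simp)
  · rw [h] at h'; simp at h'

/-! ### `SQF ≤ₚ FUND` as an `FP` brick composite -/

/-- **The reduction `SQF ≤ₚ FUND` is polynomial time**: an `f ∈ FP` with `f (bin m) = bin m` if
`m ≡ 3 (mod 4)`, `f (bin m) = bin (4m)` otherwise, and `f w = [0]` on every non-numeral `w`.
Bricks: guard `lastFalseF` (non-numeral test), test `[2 < m mod 4]` (`ltFn`, `remFn`), product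
`prodFn`, selection `iteFn`. [folklore] -/
theorem exists_sqfToFundFn : ∃ f ∈ FP, (∀ m : ℕ,
      f (encodeNat m) = encodeNat (if m % 4 = 3 then m else 4 * m)) ∧
    (∀ w : List Bool, (∀ m : ℕ, encodeNat m ≠ w) → f w = [false]) := by
  refine ⟨iteFn lastFalseF (fun _ => [false])
      (iteFn (ltFn ∘ fanoutFn (fun _ => encodeNat 2)
          (remFn ∘ fanoutFn (fun w => w) (fun _ => encodeNat 4)))
        (fun w => w) (prodFn ∘ fanoutFn (fun _ => encodeNat 4) (fun w => w))), ?_, ?_, ?_⟩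
  · exact iteFn_mem_FP lastFalseF_mem_FP (const_mem_FP _)
      (iteFn_mem_FP (comp_mem_FP ltFn_mem_FP (fanoutFn_mem_FP (const_mem_FP _)
        (comp_mem_FP remFn_mem_FP (fanoutFn_mem_FP (PolyTimeComputable.id _) (const_mem_FP _)))))
        (PolyTimeComputable.id _) (comp_mem_FP prodFn_mem_FP (fanoutFn_mem_FP (const_mem_FP _) (PolyTimeComputable.id _))))
  · intro m
    rw [iteFn_apply_false (lastFalseF_encodeNat m)]
    have htest : (ltFn ∘ fanoutFn (fun _ => encodeNat 2)
        (remFn ∘ fanoutFn (fun w => w) (fun _ => encodeNat 4))) (encodeNat m) =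
        [decide (2 < m % 4)] := by
      simp only [Function.comp_apply, fanoutFn_apply, remFn_boolPair, ltFn_boolPair,
        bitsToNat_encodeNat]
    by_cases h3 : m % 4 = 3
    · have hd : decide (2 < m % 4) = true := by rw [decide_eq_true_eq]; omega
      rw [iteFn_apply_true (by rw [htest, hd]), if_pos h3]
    · have hd : decide (2 < m % 4) = false := by rw [decide_eq_false_iff_not]; omega
      rw [iteFn_apply_false (by rw [htest, hd]), if_neg h3]
      simp only [Function.comp_apply, fanoutFn_apply, prodFn_boolPair, bitsToNat_encodeNat]
  · intro w hw
    exact iteFn_apply_true (lastFalseF_of_forall_ne hw)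

/-- **Correctness of `SQF ≤ₚ FUND`** on every word. [folklore] -/
theorem mem_squarefree_iff_sqfToFund_mem {f : List Bool → List Bool}
    (hf : ∀ m : ℕ, f (encodeNat m) = encodeNat (if m % 4 = 3 then m else 4 * m))
    (hf' : ∀ w : List Bool, (∀ m : ℕ, encodeNat m ≠ w) → f w = [false]) (w : List Bool) :
    w ∈ encodingNatBool.toLanguage {m : ℕ | Squarefree m} ↔
      f w ∈ encodingNatBool.toLanguage {d : ℕ | IsNegFundamentalDiscr d} := by
  by_cases hc : ∃ m : ℕ, encodeNat m = w
  · obtain ⟨m, rfl⟩ := hc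
    rw [hf m, encodeNat_mem_toLanguage_iff, encodeNat_mem_toLanguage_iff, Set.mem_setOf_eq,
      Set.mem_setOf_eq]
    exact squarefree_iff_isNegFundamentalDiscr_branch m
  · have hw : ∀ m : ℕ, encodeNat m ≠ w := fun m h => hc ⟨m, h⟩
    rw [hf' w hw]
    exact iff_of_false (not_mem_toLanguage_of_forall_ne _ hw) (singleton_false_not_mem_toLanguage _)

/-- **`SQF ≤ₚ FUND`** as a Karp reduction of (trivial-promise) promise problems. [folklore] -/
theorem squarefree_polyTimeReducible_fund :
    (PromiseProblem.ofLanguage (encodingNatBool.toLanguage {m : ℕ | Squarefree m})).PolyTimeReducible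
      (PromiseProblem.ofLanguage (encodingNatBool.toLanguage {d : ℕ | IsNegFundamentalDiscr d})) := by
  obtain ⟨f, hf, hval, hjunk⟩ := exists_sqfToFundFn
  refine ⟨f, hf, fun w hw => ?_, fun w hw => ?_⟩
  · exact (mem_squarefree_iff_sqfToFund_mem hval hjunk w).1 hw
  · exact fun h => hw ((mem_squarefree_iff_sqfToFund_mem hval hjunk w).2 h)

/-! ### `SQUAREFREES ∈ BQP` and the summit from either squarefree apex -/

/-- **`SQUAREFREES ∈ BQP`, unconditionally**: `SQF ≤ₚ FUND ∈ BQP` (the landed `fund_mem_BQP`: Shor's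
factoring on the odd core decides fundamentality) and `PromiseBQP` is closed downwards under Karp
reductions. [folklore] -/
theorem squarefree_mem_BQP : encodingNatBool.toLanguage {m : ℕ | Squarefree m} ∈ BQP :=
  ofLanguage_mem_PromiseBQP_iff.1 (mem_PromiseBQP_of_polyTimeReducible squarefree_polyTimeReducible_fund
    (ofLanguage_mem_PromiseBQP_iff.2 fund_mem_BQP))

/-- **The uniform squarefree apex closes the summit by itself**: if squarefreeness testing is not in
`BPP` (Adleman–McCurley's open problem, the apex `stub_sqfreeNotBPP` of crux 14864's line), then
`SQF` witnesses `BQP ⊄ BPP`. [folklore] -/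
theorem quantumAdvantage_of_squarefree_not_mem_BPP
    (h : encodingNatBool.toLanguage {m : ℕ | Squarefree m} ∉ BPP) : QuantumAdvantage :=
  ⟨_, squarefree_mem_BQP, h⟩

/-- **The apex of line `Sketch` closes the summit by itself**: `SQF ∉ P/poly → QuantumAdvantage`
(`BPP ⊆ P/poly`, Adleman, proved in the tree). [folklore] -/
theorem quantumAdvantage_of_squarefree_not_mem_PPoly
    (h : encodingNatBool.toLanguage {m : ℕ | Squarefree m} ∉ PPoly) : QuantumAdvantage :=
  quantumAdvantage_of_squarefree_not_mem_BPP fun hB => h (BPP_subset_PPoly_holds hB)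

/-- **What the apex delivers to the route**: the crux `IqThreeNotPPoly`, the binder `IqThreeNotBPP`
AND the summit — the quantum crux `IqThreeMemBQP` is not needed under the apex. [folklore] -/
theorem closes_inputs_of_squarefree_not_mem_PPoly
    (h : encodingNatBool.toLanguage {m : ℕ | Squarefree m} ∉ PPoly) :
    IqThreeNotPPoly ∧ IqThreeNotBPP ∧ QuantumAdvantage :=
  ⟨fun hIQ => h (toLanguage_squarefree_mem_PPoly_of_iqThree_nagell hIQ),
    iqThreeNotBPP_of_squarefree_not_mem_BPP fun hB => h (BPP_subset_PPoly_holds hB),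
    quantumAdvantage_of_squarefree_not_mem_PPoly h⟩

/-- The uniform version: `SQF ∉ BPP` gives the binder `IqThreeNotBPP` and the summit, with no quantum
crux. [folklore] -/
theorem closes_inputs_of_squarefree_not_mem_BPP
    (h : encodingNatBool.toLanguage {m : ℕ | Squarefree m} ∉ BPP) :
    IqThreeNotBPP ∧ QuantumAdvantage :=
  ⟨iqThreeNotBPP_of_squarefree_not_mem_BPP h, quantumAdvantage_of_squarefree_not_mem_BPP h⟩

/-! ### The converse reduction `FUND ≤ₚ SQF`: the two recognition problems coincide -/

/-- **The reduction `FUND ≤ₚ SQF` is polynomial time**: a `g ∈ FP` with `g (bin d) = bin d` if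
`d ≡ 3 (mod 4)`, `g (bin d) = bin (d / 4)` if `d ≡ 4, 8 (mod 16)`, and `g w = [0]` on every other
word (non-numerals included). Bricks: `lastFalseF`, the tests `[2 < d mod 4]`, `[0 < d mod 4]`,
`[3 < d mod 16]`, `[d mod 16 < 9]` (`ltFn`, `remFn`), the quotient `divFn`, selection `iteFn`. [folklore] -/
theorem exists_fundToSqfFn : ∃ g ∈ FP, (∀ d : ℕ,
      g (encodeNat d) = if d % 4 = 3 then encodeNat d
        else if d % 16 = 4 ∨ d % 16 = 8 then encodeNat (d / 4) else [false]) ∧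
    (∀ w : List Bool, (∀ d : ℕ, encodeNat d ≠ w) → g w = [false]) := by
  -- the four one-bit tests, as functions of the input numeral
  let t3 : List Bool → List Bool :=
    ltFn ∘ fanoutFn (fun _ => encodeNat 2) (remFn ∘ fanoutFn (fun w => w) (fun _ => encodeNat 4))
  let tA : List Bool → List Bool :=
    ltFn ∘ fanoutFn (fun _ => encodeNat 0) (remFn ∘ fanoutFn (fun w => w) (fun _ => encodeNat 4))
  let tB : List Bool → List Bool :=
    ltFn ∘ fanoutFn (fun _ => encodeNat 3) (remFn ∘ fanoutFn (fun w => w) (fun _ => encodeNat 16))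
  let tC : List Bool → List Bool :=
    ltFn ∘ fanoutFn (remFn ∘ fanoutFn (fun w => w) (fun _ => encodeNat 16)) (fun _ => encodeNat 9)
  let quarter : List Bool → List Bool := divFn ∘ fanoutFn (fun w => w) (fun _ => encodeNat 4)
  let bad : List Bool → List Bool := fun _ => [false]
  have hrem : ∀ c : ℕ, (remFn ∘ fanoutFn (fun w => w) (fun _ => encodeNat c)) ∈ FP := fun c =>
    comp_mem_FP remFn_mem_FP (fanoutFn_mem_FP (PolyTimeComputable.id _) (const_mem_FP _))
  have ht3 : t3 ∈ FP := comp_mem_FP ltFn_mem_FP (fanoutFn_mem_FP (const_mem_FP _) (hrem 4))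
  have htA : tA ∈ FP := comp_mem_FP ltFn_mem_FP (fanoutFn_mem_FP (const_mem_FP _) (hrem 4))
  have htB : tB ∈ FP := comp_mem_FP ltFn_mem_FP (fanoutFn_mem_FP (const_mem_FP _) (hrem 16))
  have htC : tC ∈ FP := comp_mem_FP ltFn_mem_FP (fanoutFn_mem_FP (hrem 16) (const_mem_FP _))
  have hq : quarter ∈ FP := comp_mem_FP divFn_mem_FP (fanoutFn_mem_FP (PolyTimeComputable.id _) (const_mem_FP _))
  have hbad : bad ∈ FP := const_mem_FP _
  -- values of the tests on numerals
  have vt3 : ∀ d : ℕ, t3 (encodeNat d) = [decide (2 < d % 4)] := fun d => by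
    simp only [t3, Function.comp_apply, fanoutFn_apply, remFn_boolPair, ltFn_boolPair,
      bitsToNat_encodeNat]
  have vtA : ∀ d : ℕ, tA (encodeNat d) = [decide (0 < d % 4)] := fun d => by
    simp only [tA, Function.comp_apply, fanoutFn_apply, remFn_boolPair, ltFn_boolPair,
      bitsToNat_encodeNat]
  have vtB : ∀ d : ℕ, tB (encodeNat d) = [decide (3 < d % 16)] := fun d => by
    simp only [tB, Function.comp_apply, fanoutFn_apply, remFn_boolPair, ltFn_boolPair,
      bitsToNat_encodeNat]
  have vtC : ∀ d : ℕ, tC (encodeNat d) = [decide (d % 16 < 9)] := fun d => by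
    simp only [tC, Function.comp_apply, fanoutFn_apply, remFn_boolPair, ltFn_boolPair,
      bitsToNat_encodeNat]
  have vq : ∀ d : ℕ, quarter (encodeNat d) = encodeNat (d / 4) := fun d => by
    simp only [quarter, Function.comp_apply, fanoutFn_apply, divFn_boolPair, bitsToNat_encodeNat]
  refine ⟨iteFn lastFalseF bad
      (iteFn t3 (fun w => w) (iteFn tA bad (iteFn tB (iteFn tC quarter bad) bad))), ?_, ?_, ?_⟩
  · exact iteFn_mem_FP lastFalseF_mem_FP hbad (iteFn_mem_FP ht3 (PolyTimeComputable.id _)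
      (iteFn_mem_FP htA hbad (iteFn_mem_FP htB (iteFn_mem_FP htC hq hbad) hbad)))
  · intro d
    rw [iteFn_apply_false (lastFalseF_encodeNat d)]
    by_cases h3 : d % 4 = 3
    · have hd : decide (2 < d % 4) = true := by rw [decide_eq_true_eq]; omega
      rw [iteFn_apply_true (by rw [vt3, hd]), if_pos h3]
    · have hd : decide (2 < d % 4) = false := by rw [decide_eq_false_iff_not]; omega
      rw [iteFn_apply_false (by rw [vt3, hd]), if_neg h3]
      by_cases hA : 0 < d % 4
      · have hdA : decide (0 < d % 4) = true := by rw [decide_eq_true_eq]; exact hA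
        rw [iteFn_apply_true (by rw [vtA, hdA]), if_neg (by omega)]
      · have hdA : decide (0 < d % 4) = false := by rw [decide_eq_false_iff_not]; exact hA
        rw [iteFn_apply_false (by rw [vtA, hdA])]
        by_cases hB : 3 < d % 16
        · have hdB : decide (3 < d % 16) = true := by rw [decide_eq_true_eq]; exact hB
          rw [iteFn_apply_true (by rw [vtB, hdB])]
          by_cases hC : d % 16 < 9
          · have hdC : decide (d % 16 < 9) = true := by rw [decide_eq_true_eq]; exact hC
            rw [iteFn_apply_true (by rw [vtC, hdC]), if_pos (by omega), vq]
          · have hdC : decide (d % 16 < 9) = false := by rw [decide_eq_false_iff_not]; exact hC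
            rw [iteFn_apply_false (by rw [vtC, hdC]), if_neg (by omega)]
        · have hdB : decide (3 < d % 16) = false := by rw [decide_eq_false_iff_not]; exact hB
          rw [iteFn_apply_false (by rw [vtB, hdB]), if_neg (by omega)]
  · intro w hw
    exact iteFn_apply_true (lastFalseF_of_forall_ne hw)

/-- **Correctness of `FUND ≤ₚ SQF`** on every word. [folklore] -/
theorem mem_fund_iff_fundToSqf_mem {g : List Bool → List Bool}
    (hg : ∀ d : ℕ, g (encodeNat d) = if d % 4 = 3 then encodeNat d
        else if d % 16 = 4 ∨ d % 16 = 8 then encodeNat (d / 4) else [false])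
    (hg' : ∀ w : List Bool, (∀ d : ℕ, encodeNat d ≠ w) → g w = [false]) (w : List Bool) :
    w ∈ encodingNatBool.toLanguage {d : ℕ | IsNegFundamentalDiscr d} ↔
      g w ∈ encodingNatBool.toLanguage {m : ℕ | Squarefree m} := by
  by_cases hc : ∃ d : ℕ, encodeNat d = w
  · obtain ⟨d, rfl⟩ := hc
    rw [hg d, encodeNat_mem_toLanguage_iff, Set.mem_setOf_eq]
    split_ifs with h3 h48
    · rw [encodeNat_mem_toLanguage_iff, Set.mem_setOf_eq]
      exact isNegFundamentalDiscr_iff_squarefree_of_mod_four h3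
    · rw [encodeNat_mem_toLanguage_iff, Set.mem_setOf_eq]
      exact isNegFundamentalDiscr_iff_squarefree_div_four h48
    · refine iff_of_false (fun hF => ?_) (singleton_false_not_mem_toLanguage _)
      rcases mod_of_isNegFundamentalDiscr hF with h | h | h
      · exact h3 h
      · exact h48 (Or.inl h)
      · exact h48 (Or.inr h)
  · have hw : ∀ d : ℕ, encodeNat d ≠ w := fun d h => hc ⟨d, h⟩
    rw [hg' w hw]
    exact iff_of_false (not_mem_toLanguage_of_forall_ne _ hw) (singleton_false_not_mem_toLanguage _)

/-- **`FUND ∈ P/poly ↔ SQF ∈ P/poly`**: fundamentality recognition and squarefreeness testing are the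
same problem for polynomial-size circuits (`P/poly` is closed under `FP` preimages). [folklore] -/
theorem fund_mem_PPoly_iff_squarefree_mem_PPoly :
    encodingNatBool.toLanguage {d : ℕ | IsNegFundamentalDiscr d} ∈ PPoly ↔
      encodingNatBool.toLanguage {m : ℕ | Squarefree m} ∈ PPoly := by
  constructor
  · intro hF
    obtain ⟨f, hf, hval, hjunk⟩ := exists_sqfToFundFn
    have hpre := preimage_mem_PPoly hF hf
    have heq : f ⁻¹' (encodingNatBool.toLanguage {d : ℕ | IsNegFundamentalDiscr d}) =
        encodingNatBool.toLanguage {m : ℕ | Squarefree m} :=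
      Set.ext fun w => (mem_squarefree_iff_sqfToFund_mem hval hjunk w).symm
    rwa [heq] at hpre
  · intro hS
    obtain ⟨g, hg, hval, hjunk⟩ := exists_fundToSqfFn
    have hpre := preimage_mem_PPoly hS hg
    have heq : g ⁻¹' (encodingNatBool.toLanguage {m : ℕ | Squarefree m}) =
        encodingNatBool.toLanguage {d : ℕ | IsNegFundamentalDiscr d} :=
      Set.ext fun w => (mem_fund_iff_fundToSqf_mem hval hjunk w).symm
    rwa [heq] at hpre

/-- **`FUND ∈ BPP ↔ SQF ∈ BPP`** (`BPP` is closed under `FP` preimages). [folklore] -/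
theorem fund_mem_BPP_iff_squarefree_mem_BPP :
    encodingNatBool.toLanguage {d : ℕ | IsNegFundamentalDiscr d} ∈ BPP ↔
      encodingNatBool.toLanguage {m : ℕ | Squarefree m} ∈ BPP := by
  constructor
  · intro hF
    obtain ⟨f, hf, hval, hjunk⟩ := exists_sqfToFundFn
    have hpre := preimage_mem_BPP hF hf
    have heq : f ⁻¹' (encodingNatBool.toLanguage {d : ℕ | IsNegFundamentalDiscr d}) =
        encodingNatBool.toLanguage {m : ℕ | Squarefree m} :=
      Set.ext fun w => (mem_squarefree_iff_sqfToFund_mem hval hjunk w).symm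
    rwa [heq] at hpre
  · intro hS
    obtain ⟨g, hg, hval, hjunk⟩ := exists_fundToSqfFn
    have hpre := preimage_mem_BPP hS hg
    have heq : g ⁻¹' (encodingNatBool.toLanguage {m : ℕ | Squarefree m}) =
        encodingNatBool.toLanguage {d : ℕ | IsNegFundamentalDiscr d} :=
      Set.ext fun w => (mem_fund_iff_fundToSqf_mem hval hjunk w).symm
    rwa [heq] at hpre

/-- **The crux from fundamentality recognition**: `FUND ∉ P/poly → IqThreeNotPPoly` (by name; with the
genus-theory collapse `IQ2 ∉ P/poly ↔ FUND ∉ P/poly` this says the `ℓ = 2` analogue of X implies X).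
[folklore] -/
theorem iqThreeNotPPoly_of_fund_not_mem_PPoly
    (h : encodingNatBool.toLanguage {d : ℕ | IsNegFundamentalDiscr d} ∉ PPoly) : IqThreeNotPPoly :=
  fun hIQ => h (fund_mem_PPoly_iff_squarefree_mem_PPoly.2
    (toLanguage_squarefree_mem_PPoly_of_iqThree_nagell hIQ))

/-- The uniform twin: `FUND ∉ BPP → IqThreeNotBPP`. [folklore] -/
theorem iqThreeNotBPP_of_fund_not_mem_BPP
    (h : encodingNatBool.toLanguage {d : ℕ | IsNegFundamentalDiscr d} ∉ BPP) : IqThreeNotBPP :=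
  iqThreeNotBPP_of_squarefree_not_mem_BPP fun hS => h (fund_mem_BPP_iff_squarefree_mem_BPP.2 hS)

/-- … and `FUND ∉ BPP` closes the summit by itself too (witness `FUND`, `fund_mem_BQP`). [folklore] -/
theorem quantumAdvantage_of_fund_not_mem_BPP
    (h : encodingNatBool.toLanguage {d : ℕ | IsNegFundamentalDiscr d} ∉ BPP) : QuantumAdvantage :=
  ⟨_, fund_mem_BQP, h⟩

end Summit.QuantumAdvantage.QuantumAdvantage.Theorems.IqThreeNotPPoly

end
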